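import Mathlib
import HarnessLib

/-!
# Cell pnp-psdrank, route `ChebyshevTracialDesign`: the TYPE-AVERAGING REDUCTION for block-symmetric pair kernels — a quadratic form in an
# arbitrary pair-symmetric direction is at most its value at the type-averaged direction plus the DIAGONAL EXCESS — brick 145b
# (crux `TracialDecayExp20`, stmt-PneNP-19878)

Brick 145b (prover g29; MEMO-32 §3). Pure finite linear algebra, no cuts or matchings. Setting: a finite index type `ι` ("vertices") with a
fixed-point-free involution `π` ("partner"), a class map `τ : ι → K` constant on partner pairs ("edge type"), and a symmetric kernel `A : ι → ι → ℝ`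
with `A p (πq) = A p q` which is BLOCK-SYMMETRIC in the sense of two single-swap facts: (row) for fixed `p`, `q ↦ A p q` is constant on each class
outside the pair `{p, πp}`; (block) the class sums `Σ_{τ q = k} A p q` depend on `p` only through `τ p`. (For the pair-pinned design-value matrix
`A_M(p,q) = Σ_U W(U,M)ψ(|U∩H|)x_px_{πp}x_qx_{πq}` of an `H`-symmetric mask both facts come from the vertex permutations swapping two same-type edges
of `M`, brick 145a.) For a pair-symmetric direction `c : ι → [−1,1]` let `v` be its TYPE AVERAGE (`v p` = mean of `c` over the class of `p`) and
`w = c − v`. THEN (`quadForm_le_typeAvg_add_excess`):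
  `Σ_{p,q} c_p c_q A(p,q) ≤ Σ_{p,q} v_p v_q A(p,q) + 8·Σ_p Σ_{q ∉ {p,πp}} (A(p,p) − A(p,q))₊`.
Proof: `Σ cc A − Σ vvA = 2Σ_p w_p β(p) + Σ_p w_p Σ_q w_q A(p,q)` with `β(p) = Σ_q v_q A(p,q)` a class function (block fact), so the first sum vanishes
class by class (`Σ_{class} w = 0`); by the row fact `Σ_q w_q A(p,q) = 2w_p(A(p,p) − A(p,q₀))` for any same-class `q₀ ∉ {p,πp}` (and `w_p = 0` if there
is none), and `2w_p² ≤ 8`. Also: `|v| ≤ 1`, `v ∘ π = v`, `v` is a class function (`typeAvg_abs_le_one`, `typeAvg_comp_partner`, `typeAvg_eq_of_type_eq`).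
WHAT THIS FILE DOES NOT DO: anything about cuts, matchings, designs; anything on `TracialDecayExp20` itself, psd rank of P_PM(K_n), or P vs NP.
[cite: Rothvoss2017, §2 (PDF pp. 5–6)] (the three edge types of a matching relative to a block) [folklore] (variance decomposition of an exchangeable
quadratic form)
Stature: support/instrument (kernel lane, no defs, axioms standard). Supports stmt-PneNP-19878.
-/

set_option linter.dupNamespace false -- `Summit.PneNP.PneNP.…`: summit = sub-problem (D-0017)

noncomputable section

namespace Summit.PneNP.PneNP.Theorems.ChebyshevTracialDesignTypeAveraging

open Finset

variable {ι K : Type*} [Fintype ι] [DecidableEq K]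

/-! ### §1 The type average -/

/-- The type average of a `[−1,1]`-valued function is `[−1,1]`-valued. [folklore] -/
theorem typeAvg_abs_le_one (τ : ι → K) (c : ι → ℝ) (hc : ∀ p, |c p| ≤ 1) (v : ι → ℝ)
    (hv : ∀ p, v p = (∑ q ∈ univ.filter (fun q => τ q = τ p), c q) / ((univ.filter fun q => τ q = τ p).card : ℝ)) (p : ι) :
    |v p| ≤ 1 := by
  rw [hv]
  have hmem : p ∈ univ.filter (fun q => τ q = τ p) := by simp
  have hpos : (0 : ℝ) < ((univ.filter fun q => τ q = τ p).card : ℝ) := by exact_mod_cast card_pos.2 ⟨p, hmem⟩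
  rw [abs_div, abs_of_pos hpos, div_le_one hpos]
  calc |∑ q ∈ univ.filter (fun q => τ q = τ p), c q| ≤ ∑ q ∈ univ.filter (fun q => τ q = τ p), |c q| := abs_sum_le_sum_abs _ _
    _ ≤ ∑ _q ∈ univ.filter (fun q => τ q = τ p), (1 : ℝ) := sum_le_sum fun q _ => hc q
    _ = _ := by rw [sum_const, nsmul_eq_mul, mul_one]

/-- The type average is a class function. [folklore] -/
theorem typeAvg_eq_of_type_eq (τ : ι → K) (c : ι → ℝ) (v : ι → ℝ)
    (hv : ∀ p, v p = (∑ q ∈ univ.filter (fun q => τ q = τ p), c q) / ((univ.filter fun q => τ q = τ p).card : ℝ))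
    {p p' : ι} (h : τ p = τ p') : v p = v p' := by
  rw [hv, hv, h]

/-- The type average is pair-symmetric when the class map is. [folklore] -/
theorem typeAvg_comp_partner (π : ι → ι) (τ : ι → K) (hτ : ∀ p, τ (π p) = τ p) (c : ι → ℝ) (v : ι → ℝ)
    (hv : ∀ p, v p = (∑ q ∈ univ.filter (fun q => τ q = τ p), c q) / ((univ.filter fun q => τ q = τ p).card : ℝ)) (p : ι) :
    v (π p) = v p :=
  typeAvg_eq_of_type_eq τ c v hv (hτ p)

/-! ### §2 The reduction -/

/-- **TYPE-AVERAGING REDUCTION (brick 145b).** For a fixed-point-free involution `π` on `ι`, a class map `τ` with `τ ∘ π = τ`, a symmetric kernel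
`A` with `A p (πq) = A p q` satisfying the ROW fact (`q ↦ A p q` constant on each class outside `{p, πp}`) and the BLOCK fact (class sums of
`A p ·` depend only on `τ p`), a pair-symmetric `c : ι → [−1,1]` and its type average `v`:
`Σ_{p,q} c_p c_q A(p,q) ≤ Σ_{p,q} v_p v_q A(p,q) + 8·Σ_p Σ_{q ∉ {p,πp}} (A(p,p) − A(p,q))₊`. [folklore] -/
theorem quadForm_le_typeAvg_add_excess [DecidableEq ι] [Fintype K] (π : ι → ι) (hπ' : ∀ p, π p ≠ p)
    (τ : ι → K) (hτ : ∀ p, τ (π p) = τ p)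
    (A : ι → ι → ℝ) (hAs : ∀ p q, A p q = A q p) (hAπ : ∀ p q, A p (π q) = A p q)
    (hrow : ∀ p q q', q ≠ p → q ≠ π p → q' ≠ p → q' ≠ π p → τ q = τ q' → A p q = A p q')
    (hB : ∀ p p', τ p = τ p' → ∀ k,
      ∑ q ∈ univ.filter (fun q => τ q = k), A p q = ∑ q ∈ univ.filter (fun q => τ q = k), A p' q)
    (c : ι → ℝ) (hcπ : ∀ p, c (π p) = c p) (hc : ∀ p, |c p| ≤ 1) (v : ι → ℝ)
    (hv : ∀ p, v p = (∑ q ∈ univ.filter (fun q => τ q = τ p), c q) / ((univ.filter fun q => τ q = τ p).card : ℝ)) :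
    ∑ p, ∑ q, c p * c q * A p q ≤ ∑ p, ∑ q, v p * v q * A p q +
      8 * ∑ p, ∑ q ∈ univ.filter (fun q => q ≠ p ∧ q ≠ π p), max (A p p - A p q) 0 := by
  classical
  -- class sets and class averages
  have hmemS : ∀ k q, q ∈ univ.filter (fun q => τ q = k) ↔ τ q = k := fun k q => by simp
  have hvconst : ∀ k, ∀ q ∈ univ.filter (fun q => τ q = k), v q =
      (∑ r ∈ univ.filter (fun r => τ r = k), c r) / ((univ.filter fun r => τ r = k).card : ℝ) := by
    intro k q hq; rw [hv, (hmemS k q).1 hq]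
  have hv1 : ∀ p, |v p| ≤ 1 := typeAvg_abs_le_one τ c hc v hv
  have hvτ : ∀ p p', τ p = τ p' → v p = v p' := fun p p' h => typeAvg_eq_of_type_eq τ c v hv h
  -- the fluctuation `w = c − v`
  obtain ⟨w, hw⟩ : ∃ w : ι → ℝ, ∀ p, w p = c p - v p := ⟨fun p => c p - v p, fun p => rfl⟩
  have hwπ : ∀ p, w (π p) = w p := fun p => by rw [hw, hw, hcπ, typeAvg_comp_partner π τ hτ c v hv]
  have hwsum : ∀ k, ∑ q ∈ univ.filter (fun q => τ q = k), w q = 0 := by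
    intro k
    have hvs : ∑ q ∈ univ.filter (fun q => τ q = k), v q = ∑ q ∈ univ.filter (fun q => τ q = k), c q := by
      rw [sum_congr rfl (hvconst k), sum_const, nsmul_eq_mul]
      rcases Nat.eq_zero_or_pos ((univ.filter fun r => τ r = k).card) with h0 | hpos
      · rw [card_eq_zero.1 h0]; simp
      · have : ((univ.filter fun r => τ r = k).card : ℝ) ≠ 0 := by positivity
        field_simp
    simp only [hw, sum_sub_distrib, hvs, sub_self]
  have hw2 : ∀ p, w p ^ 2 ≤ 4 := by
    intro p
    have h1 := abs_le.1 (hc p); have h2 := abs_le.1 (hv1 p)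
    rw [hw]; nlinarith [h1.1, h1.2, h2.1, h2.2]
  -- `β p = Σ_q v_q A p q` is a class function (block fact)
  have hvA : ∀ p k, ∑ q ∈ univ.filter (fun q => τ q = k), v q * A p q =
      (∑ r ∈ univ.filter (fun r => τ r = k), c r) / ((univ.filter fun r => τ r = k).card : ℝ) *
        ∑ q ∈ univ.filter (fun q => τ q = k), A p q := by
    intro p k
    rw [mul_sum]
    exact sum_congr rfl fun q hq => by rw [hvconst k q hq]
  have hβ : ∀ p p', τ p = τ p' → ∑ q, v q * A p q = ∑ q, v q * A p' q := by
    intro p p' hpp'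
    rw [← sum_fiberwise univ τ (fun q => v q * A p q), ← sum_fiberwise univ τ (fun q => v q * A p' q)]
    refine sum_congr rfl fun k _ => ?_
    rw [hvA p k, hvA p' k, hB p p' hpp' k]
  -- T1 = Σ_p w_p β_p = 0, class by class
  have hT1 : ∑ p, w p * ∑ q, v q * A p q = 0 := by
    rw [← sum_fiberwise univ τ (fun p => w p * ∑ q, v q * A p q)]
    refine sum_eq_zero fun k _ => ?_
    rcases (univ.filter fun p => τ p = k).eq_empty_or_nonempty with he | ⟨p₀, hp₀⟩
    · rw [he, sum_empty]
    · have hτ₀ : τ p₀ = k := (hmemS k p₀).1 hp₀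
      rw [sum_congr rfl (fun p hp => by rw [hβ p p₀ (((hmemS k p).1 hp).trans hτ₀.symm)]), ← sum_mul, hwsum k, zero_mul]
  -- T2: the row identity and the excess bound, per `p`
  have hT2 : ∀ p, w p * ∑ q, w q * A p q ≤ 8 * ∑ q ∈ univ.filter (fun q => q ≠ p ∧ q ≠ π p), max (A p p - A p q) 0 := by
    intro p
    have hnn : 0 ≤ ∑ q ∈ univ.filter (fun q => q ≠ p ∧ q ≠ π p), max (A p p - A p q) 0 :=
      sum_nonneg fun _ _ => le_max_right _ _
    by_cases hex : ∃ q₀, q₀ ≠ p ∧ q₀ ≠ π p ∧ τ q₀ = τ p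
    · obtain ⟨q₀, hq₀p, hq₀π, hq₀τ⟩ := hex
      -- the row sum, class by class
      have hcls : ∀ k, ∑ q ∈ univ.filter (fun q => τ q = k), w q * A p q =
          if k = τ p then 2 * w p * (A p p - A p q₀) else 0 := by
        intro k
        split_ifs with hk
        · -- the class of `p`: `{p, πp}` and the rest, on which `A p q = A p q₀`
          have hsplit : univ.filter (fun q => τ q = k) =
              {p, π p} ∪ (univ.filter (fun q => τ q = k)).filter (fun q => q ≠ p ∧ q ≠ π p) := by
            ext q
            simp only [mem_union, mem_insert, mem_singleton, mem_filter, mem_univ, true_and]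
            constructor
            · intro hq
              by_cases h1 : q = p
              · exact Or.inl (Or.inl h1)
              by_cases h2 : q = π p
              · exact Or.inl (Or.inr h2)
              exact Or.inr ⟨hq, h1, h2⟩
            · rintro (h | h)
              · rcases h with rfl | rfl
                · exact hk.symm
                · rw [hτ]; exact hk.symm
              · exact h.1
          have hdisj : Disjoint ({p, π p} : Finset ι) ((univ.filter (fun q => τ q = k)).filter (fun q => q ≠ p ∧ q ≠ π p)) := by
            rw [disjoint_left]
            intro q hq hq'
            simp only [mem_insert, mem_singleton] at hq
            simp only [mem_filter, mem_univ, true_and] at hq'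
            rcases hq with rfl | rfl
            · exact hq'.2.1 rfl
            · exact hq'.2.2 rfl
          rw [hsplit, sum_union hdisj, sum_pair (hπ' p).symm, hwπ, hAπ]
          have hrest : ∑ q ∈ (univ.filter (fun q => τ q = k)).filter (fun q => q ≠ p ∧ q ≠ π p), w q * A p q =
              (∑ q ∈ (univ.filter (fun q => τ q = k)).filter (fun q => q ≠ p ∧ q ≠ π p), w q) * A p q₀ := by
            rw [sum_mul]
            refine sum_congr rfl fun q hq => ?_
            simp only [mem_filter, mem_univ, true_and] at hq
            rw [hrow p q q₀ hq.2.1 hq.2.2 hq₀p hq₀π (hq.1.trans (hk.trans hq₀τ.symm))]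
          have hwrest : ∑ q ∈ (univ.filter (fun q => τ q = k)).filter (fun q => q ≠ p ∧ q ≠ π p), w q = -(2 * w p) := by
            have h := hwsum k
            rw [hsplit, sum_union hdisj, sum_pair (hπ' p).symm, hwπ] at h
            linarith
          rw [hrest, hwrest]
          ring
        · -- another class: all its members are outside `{p, πp}`, `A p ·` is constant there and `Σ w = 0`
          rcases (univ.filter fun q => τ q = k).eq_empty_or_nonempty with he | ⟨q₁, hq₁⟩
          · rw [he, sum_empty]
          · have hτ₁ : τ q₁ = k := (hmemS k q₁).1 hq₁
            have hq₁p : q₁ ≠ p := fun h => hk (by rw [← hτ₁, h])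
            have hq₁π : q₁ ≠ π p := fun h => hk (by rw [← hτ₁, h, hτ])
            rw [sum_congr rfl (fun q hq => by
              have hτq : τ q = k := (hmemS k q).1 hq
              have hqp : q ≠ p := fun h => hk (by rw [← hτq, h])
              have hqπ : q ≠ π p := fun h => hk (by rw [← hτq, h, hτ])
              rw [hrow p q q₁ hqp hqπ hq₁p hq₁π (hτq.trans hτ₁.symm)]), ← sum_mul, hwsum k, zero_mul]
      have key : ∑ q, w q * A p q = 2 * w p * (A p p - A p q₀) := by
        rw [← sum_fiberwise univ τ (fun q => w q * A p q), sum_congr rfl (fun k _ => hcls k)]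
        simp
      rw [key]
      have hq₀mem : q₀ ∈ univ.filter (fun q => q ≠ p ∧ q ≠ π p) := by simp [hq₀p, hq₀π]
      have hsingle : max (A p p - A p q₀) 0 ≤ ∑ q ∈ univ.filter (fun q => q ≠ p ∧ q ≠ π p), max (A p p - A p q) 0 :=
        single_le_sum (f := fun q => max (A p p - A p q) 0) (fun _ _ => le_max_right _ _) hq₀mem
      have hle : A p p - A p q₀ ≤ max (A p p - A p q₀) 0 := le_max_left _ _
      have hm0 : 0 ≤ max (A p p - A p q₀) 0 := le_max_right _ _
      nlinarith [hw2 p, sq_nonneg (w p), hsingle, hle, hm0]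
    · -- no same-class vertex outside the pair: then `w p = 0`
      push Not at hex
      have hcl : univ.filter (fun q => τ q = τ p) = {p, π p} := by
        ext q
        simp only [mem_filter, mem_univ, true_and, mem_insert, mem_singleton]
        constructor
        · intro hq
          by_contra h
          push Not at h
          exact hex q h.1 h.2 hq
        · rintro (rfl | rfl)
          · rfl
          · exact hτ p
      have h := hwsum (τ p)
      rw [hcl, sum_pair (hπ' p).symm, hwπ] at h
      have hw0 : w p = 0 := by linarith
      rw [hw0, zero_mul]
      linarith
  -- expansion of the quadratic form
  have hcw : ∀ p, c p = v p + w p := fun p => by rw [hw]; ring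
  have hexp : ∑ p, ∑ q, c p * c q * A p q =
      ∑ p, ∑ q, v p * v q * A p q + ∑ p, w p * ∑ q, v q * A p q + ∑ q, w q * ∑ p, v p * A p q +
        ∑ p, w p * ∑ q, w q * A p q := by
    have h1 : ∀ p q, c p * c q * A p q =
        v p * v q * A p q + w p * (v q * A p q) + w q * (v p * A p q) + w p * (w q * A p q) := by
      intro p q; rw [hcw p, hcw q]; ring
    simp only [h1, sum_add_distrib, mul_sum]
    rw [sum_comm (f := fun p q => w q * (v p * A p q))]
  have hsymm : ∑ q, w q * ∑ p, v p * A p q = ∑ q, w q * ∑ p, v p * A q p := by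
    refine sum_congr rfl fun q _ => ?_
    rw [sum_congr rfl (fun p _ => by rw [hAs p q])]
  rw [hexp, hsymm, hT1]
  have := sum_le_sum fun p (_ : p ∈ (univ : Finset ι)) => hT2 p
  rw [← mul_sum] at this
  linarith

end Summit.PneNP.PneNP.Theorems.ChebyshevTracialDesignTypeAveraging

end
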